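import Summits.AtomisticToContinuum.HydrodynamicLimit.Theses.CollisionIsometryCLT
import Literature.MathematicalPhysics.KineticTheory.HardSphereEulerProofs

/-!
# `AprioriBounds` (stmt-AtomisticToContinuum-9519), negative knowledge 5/7: the critical exponential moment

Load-bearing analysis of the crux `CollisionIsometryCLT.AprioriBounds` by the standing disprover
(`Cruxes/AprioriBounds/Disproof.lean`, refuter-cdisprove-stmt-AtomisticToContinuum-9519-0).

Component (i) of the crux asks for SOME `λ > 0` with the time-averaged empirical moment
`∫₀ᵗ (N+1)⁻¹∑ᵢ exp(λ|vᵢ(s)|²) ds` bounded in probability.  Why `λ` must be existential: under the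
Maxwellian `N(0, θ̄ I₃)` the one-particle moment `E exp(λ|v|²)` is finite iff `λ < 1/(2θ̄)`.  This
file proves the particle-system form of the critical divergence at `λ = 1/(2θ̄)` under the
homogeneous local Gibbs law (`a₀ = 1`, `u₀ = 0`, `θ₀ = θ̄`, `σ ≤ 1/2`): for every level `a`,
`P_N{(N+1)⁻¹∑ᵢ exp(|vᵢ|²/(2θ̄)) ≤ a} → 0` (`tendsto_localGibbsMeasure_expAvg_le`).  Proof: the
truncated weight `1_{|v|≤R} exp(|v|²/2θ̄)` has Maxwellian mean `(2πθ̄)^{-3/2}|B_R|` EXACTLY (the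
Gaussian is cancelled; `integral_truncExp`), unbounded in `R`; truncate at a radius whose mean is
`≥ a + 1` and apply Bienaymé–Chebyshev given the positions (`localGibbsMeasure_velFluct_le` of the
`HardSphereEuler` LLN file).  Used by file 7/7 (`AllLambda`).
-/

noncomputable section

open MeasureTheory ProbabilityTheory Filter Set Topology Metric
open scoped ENNReal

namespace Summit.AtomisticToContinuum.HydrodynamicLimit.Theorems

namespace AprioriBoundsNegative

open Literature.MathematicalPhysics.KineticTheory Literature.Analysis.FluidPDE

/-! ### The critical exponential moment: truncations have unbounded Maxwellian means -/

/-- The truncated critical weight `1_{|v| ≤ R} exp(|v|²/(2θ̄))` is nonnegative. -/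
theorem truncExp_nonneg (θb R : ℝ) (v : V3) :
    0 ≤ (closedBall (0 : V3) R).indicator (fun v => Real.exp (‖v‖ ^ 2 / (2 * θb))) v :=
  Set.indicator_nonneg (fun _ _ => (Real.exp_pos _).le) v

/-- The truncated weight is below the full weight `exp(|v|²/(2θ̄))`. -/
theorem truncExp_le_exp (θb R : ℝ) (v : V3) :
    (closedBall (0 : V3) R).indicator (fun v => Real.exp (‖v‖ ^ 2 / (2 * θb))) v ≤
      Real.exp (‖v‖ ^ 2 / (2 * θb)) :=
  Set.indicator_le_self' (fun _ _ => (Real.exp_pos _).le) v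

/-- The truncated weight is bounded by `exp(R²/(2θ̄))`. -/
theorem truncExp_le {θb : ℝ} (hθ : 0 < θb) (R : ℝ) (v : V3) :
    (closedBall (0 : V3) R).indicator (fun v => Real.exp (‖v‖ ^ 2 / (2 * θb))) v ≤ Real.exp (R ^ 2 / (2 * θb)) := by
  refine Set.indicator_apply_le' (fun hv => ?_) (fun _ => (Real.exp_pos _).le)
  rw [mem_closedBall_zero_iff] at hv
  exact Real.exp_le_exp.2 (div_le_div_of_nonneg_right
    (pow_le_pow_left₀ (norm_nonneg _) hv 2) (by positivity))

/-- The truncated weight is measurable. -/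
theorem measurable_truncExp (θb R : ℝ) :
    Measurable ((closedBall (0 : V3) R).indicator (fun v => Real.exp (‖v‖ ^ 2 / (2 * θb)))) :=
  (by fun_prop : Measurable fun v : V3 => Real.exp (‖v‖ ^ 2 / (2 * θb))).indicator
    measurableSet_closedBall

/-- **The Maxwellian mean of the truncated critical weight**: `E_{N(0,θ)} 1_{|v|≤R} e^{|v|²/2θ} =
(2πθ)^{-3/2} · |B_R|` — the Gaussian density is exactly cancelled. -/
theorem integral_truncExp {θb : ℝ} (hθ : 0 < θb) {R : ℝ} (hR : 0 ≤ R) :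
    ∫ v, (closedBall (0 : V3) R).indicator (fun v => Real.exp (‖v‖ ^ 2 / (2 * θb))) v ∂gaussMeasure (0 : V3) θb =
      (2 * Real.pi * θb) ^ (-(3 : ℝ) / 2) * (R ^ 3 * (Real.pi * 4 / 3)) := by
  rw [← withDensity_localMaxwellian_eq_gaussMeasure hθ (0 : V3),
    integral_withDensity_eq_integral_toReal_smul₀
      (continuous_localMaxwellian 1 θb (0 : V3)).measurable.ennreal_ofReal.aemeasurable
      (Eventually.of_forall fun _ => ENNReal.ofReal_lt_top)]
  simp_rw [ENNReal.toReal_ofReal (localMaxwellian_nonneg zero_le_one hθ.le (0 : V3) _)]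
  have hpt : ∀ v : V3, localMaxwellian 1 θb (0 : V3) v • (closedBall (0 : V3) R).indicator (fun v => Real.exp (‖v‖ ^ 2 / (2 * θb))) v =
      (2 * Real.pi * θb) ^ (-(3 : ℝ) / 2) * (closedBall (0 : V3) R).indicator (fun _ => (1 : ℝ)) v := by
    intro v
    by_cases hv : v ∈ closedBall (0 : V3) R
    · rw [Set.indicator_of_mem hv, Set.indicator_of_mem hv, smul_eq_mul, localMaxwellian,
        one_mul, sub_zero, finrank_euclideanSpace, Fintype.card_fin, mul_one, mul_assoc,
        ← Real.exp_add]
      have : -‖v‖ ^ 2 / (2 * θb) + ‖v‖ ^ 2 / (2 * θb) = 0 := by ring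
      rw [this, Real.exp_zero, mul_one]
      norm_num
    · rw [Set.indicator_of_notMem hv, Set.indicator_of_notMem hv, smul_zero, mul_zero]
  simp_rw [hpt]
  rw [integral_const_mul, integral_indicator_const (1 : ℝ) measurableSet_closedBall, smul_eq_mul,
    mul_one]
  congr 1
  rw [Measure.real, EuclideanSpace.volume_closedBall_fin_three, ENNReal.toReal_mul,
    ← ENNReal.ofReal_pow hR, ENNReal.toReal_ofReal (by positivity),
    ENNReal.toReal_ofReal (by positivity)]

/-- For every level `L` some truncation has Maxwellian mean `≥ L` (the critical exponential moment
is infinite). -/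
theorem exists_integral_truncExp_ge {θb : ℝ} (hθ : 0 < θb) (L : ℝ) :
    ∃ R : ℝ, 0 ≤ R ∧ L ≤ ∫ v, (closedBall (0 : V3) R).indicator (fun v => Real.exp (‖v‖ ^ 2 / (2 * θb))) v ∂gaussMeasure (0 : V3) θb := by
  set κ : ℝ := (2 * Real.pi * θb) ^ (-(3 : ℝ) / 2) * (Real.pi * 4 / 3) with hκ
  have hκ0 : 0 < κ := by positivity
  refine ⟨max 1 (L / κ), le_trans zero_le_one (le_max_left _ _), ?_⟩
  rw [integral_truncExp hθ (le_trans zero_le_one (le_max_left _ _))]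
  have h1 : 1 ≤ max 1 (L / κ) := le_max_left _ _
  have hcube : max 1 (L / κ) ≤ (max 1 (L / κ)) ^ 3 := le_self_pow₀ h1 three_ne_zero
  calc L = κ * (L / κ) := by field_simp
    _ ≤ κ * max 1 (L / κ) := by gcongr; exact le_max_right _ _
    _ ≤ κ * (max 1 (L / κ)) ^ 3 := by gcongr
    _ = (2 * Real.pi * θb) ^ (-(3 : ℝ) / 2) * ((max 1 (L / κ)) ^ 3 * (Real.pi * 4 / 3)) := by
        rw [hκ]; ring

/-- **Lower tail of the critical empirical exponential moment under the homogeneous local Gibbs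
law.** At `λ = 1/(2θ̄)` the one-particle Maxwellian moment `E exp(λ|v|²)` is infinite, so the
empirical average `(N+1)⁻¹ ∑ᵢ exp(|vᵢ|²/(2θ̄))` exceeds every fixed level `a` with probability
`→ 1`: truncate at a radius `R` whose truncated mean is `≥ a + 1` (`exists_integral_truncExp_ge`)
and apply Bienaymé–Chebyshev given the positions (`localGibbsMeasure_velFluct_le`). -/
theorem tendsto_localGibbsMeasure_expAvg_le {σ θb : ℝ} (hσ2 : σ ≤ 1 / 2) (hθ : 0 < θb) (a : ℝ) :
    Tendsto (fun N : ℕ => localGibbsMeasure σ (fun _ => 1) (fun _ => 0) (fun _ => θb) N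
      {z | ((N + 1 : ℕ) : ℝ)⁻¹ * ∑ i, Real.exp (‖(z i).2‖ ^ 2 / (2 * θb)) ≤ a}) atTop (𝓝 0) := by
  obtain ⟨R, hR, hm⟩ := exists_integral_truncExp_ge hθ (a + 1)
  set m : ℝ := ∫ v, (closedBall (0 : V3) R).indicator (fun v => Real.exp (‖v‖ ^ 2 / (2 * θb))) v ∂gaussMeasure (0 : V3) θb with hmdef
  set K : ℝ := Real.exp (R ^ 2 / (2 * θb)) with hK
  have hK0 : 0 ≤ K := (Real.exp_pos _).le
  have ha : Continuous fun _ : T3 => (1 : ℝ) := continuous_const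
  have hu : Continuous fun _ : T3 => (0 : V3) := continuous_const
  have hθc : Continuous fun _ : T3 => θb := continuous_const
  -- integrability facts for the truncated weight under the Maxwellian
  have hWint : Integrable ((closedBall (0 : V3) R).indicator (fun v => Real.exp (‖v‖ ^ 2 / (2 * θb)))) (gaussMeasure (0 : V3) θb) :=
    Integrable.of_bound (measurable_truncExp θb R).aestronglyMeasurable K
      (Eventually.of_forall fun v => by
        rw [Real.norm_eq_abs, abs_of_nonneg (truncExp_nonneg θb R v)]; exact truncExp_le hθ R v)
  have hm0 : 0 ≤ m := integral_nonneg fun v => truncExp_nonneg θb R v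
  have hmK : m ≤ K := by
    calc m ≤ ∫ _v, K ∂gaussMeasure (0 : V3) θb :=
          integral_mono hWint (integrable_const K) fun v => truncExp_le hθ R v
      _ = K := by simp
  have hYbd : ∀ v : V3, |(closedBall (0 : V3) R).indicator (fun v => Real.exp (‖v‖ ^ 2 / (2 * θb))) v - m| ≤ K := fun v => by
    rw [abs_le]
    constructor <;> linarith [truncExp_nonneg θb R v, truncExp_le hθ R v]
  have hY2 : MemLp (fun v : V3 => (closedBall (0 : V3) R).indicator (fun v => Real.exp (‖v‖ ^ 2 / (2 * θb))) v - m) 2 (gaussMeasure (0 : V3) θb) :=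
    MemLp.of_bound ((measurable_truncExp θb R).sub measurable_const).aestronglyMeasurable K
      (Eventually.of_forall fun v => by rw [Real.norm_eq_abs]; exact hYbd v)
  have hY0 : ∫ v, ((closedBall (0 : V3) R).indicator (fun v => Real.exp (‖v‖ ^ 2 / (2 * θb))) v - m) ∂gaussMeasure (0 : V3) θb = 0 := by
    rw [integral_sub hWint (integrable_const m), ← hmdef]
    simp
  have hYB : Var[fun v : V3 => (closedBall (0 : V3) R).indicator (fun v => Real.exp (‖v‖ ^ 2 / (2 * θb))) v - m; gaussMeasure (0 : V3) θb] ≤ K ^ 2 := by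
    refine (variance_le_expectation_sq
      ((measurable_truncExp θb R).sub measurable_const).aestronglyMeasurable).trans ?_
    show ∫ v, ((closedBall (0 : V3) R).indicator (fun v => Real.exp (‖v‖ ^ 2 / (2 * θb))) v - m) ^ 2 ∂gaussMeasure (0 : V3) θb ≤ K ^ 2
    calc ∫ v, ((closedBall (0 : V3) R).indicator (fun v => Real.exp (‖v‖ ^ 2 / (2 * θb))) v - m) ^ 2 ∂gaussMeasure (0 : V3) θb
        ≤ ∫ _v, K ^ 2 ∂gaussMeasure (0 : V3) θb := by
          refine integral_mono hY2.integrable_sq (integrable_const _) fun v => ?_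
          have := hYbd v
          simp only
          rw [← sq_abs]
          exact pow_le_pow_left₀ (abs_nonneg _) this 2
      _ = K ^ 2 := by simp
  -- Chebyshev given the positions, for every `N`
  have hcheb : ∀ N : ℕ, localGibbsMeasure σ (fun _ => 1) (fun _ => 0) (fun _ => θb) N
      {z | ((N + 1 : ℕ) : ℝ)⁻¹ * ∑ i, Real.exp (‖(z i).2‖ ^ 2 / (2 * θb)) ≤ a} ≤
      ENNReal.ofReal ((1 : ℝ) ^ 2 * K ^ 2 / ((N + 1 : ℕ) * (1 : ℝ) ^ 2)) := by
    intro N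
    haveI := isProbabilityMeasure_localGibbsMeasure (u₀ := fun _ => (0 : V3)) ha hθc hu
      (fun _ => one_pos) (fun _ => hθ) hσ2 N
    have h := localGibbsMeasure_velFluct_le (a₀ := fun _ => (1 : ℝ)) (θ₀ := fun _ => θb)
      (u₀ := fun _ => (0 : V3)) ha hθc hu (fun _ => zero_le_one) (fun _ => hθ) σ N
      (Y := fun _ v => (closedBall (0 : V3) R).indicator (fun v => Real.exp (‖v‖ ^ 2 / (2 * θb))) v - m)
      (((measurable_truncExp θb R).sub measurable_const).comp measurable_snd)
      (fun _ => hY2) (fun _ => hY0) (B := K ^ 2) (fun _ => hYB)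
      (χ := fun _ => (1 : ℝ)) continuous_const (C := 1) (fun _ => by simp) (δ := 1) one_pos
    refine le_trans (measure_mono fun z hz => ?_) h
    simp only [mem_setOf_eq, one_mul] at hz ⊢
    have hsum : ((N + 1 : ℕ) : ℝ)⁻¹ * ∑ i, ((closedBall (0 : V3) R).indicator (fun v => Real.exp (‖v‖ ^ 2 / (2 * θb))) (z i).2 - m) =
        ((N + 1 : ℕ) : ℝ)⁻¹ * ∑ i, (closedBall (0 : V3) R).indicator (fun v => Real.exp (‖v‖ ^ 2 / (2 * θb))) (z i).2 - m := by
      rw [Finset.sum_sub_distrib, Finset.sum_const, Finset.card_univ, Fintype.card_fin,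
        nsmul_eq_mul, mul_sub, ← mul_assoc, inv_mul_cancel₀ (by positivity), one_mul]
    have havg : ((N + 1 : ℕ) : ℝ)⁻¹ * ∑ i, (closedBall (0 : V3) R).indicator (fun v => Real.exp (‖v‖ ^ 2 / (2 * θb))) (z i).2 ≤ a :=
      le_trans (mul_le_mul_of_nonneg_left
        (Finset.sum_le_sum fun i _ => truncExp_le_exp θb R (z i).2) (by positivity)) hz
    rw [hsum, le_abs]
    right
    linarith
  refine tendsto_of_tendsto_of_tendsto_of_le_of_le tendsto_const_nhds
    (tendsto_ofReal_div_succ_mul ((1 : ℝ) ^ 2 * K ^ 2) ((1 : ℝ) ^ 2)) (fun N => zero_le) hcheb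

end AprioriBoundsNegative

end Summit.AtomisticToContinuum.HydrodynamicLimit.Theorems

end
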